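import Summits.BirchSwinnertonDyer.Rank1Residual.X11b.Three.RouteR1TamagawaPlaces
import HarnessLib

/-!
# X11b at `p = 3`, route R1's descent — link (C), part 2: the Tamagawa descent PROVED at every odd prime on erratum fields; the `p = 3` stub discharged (cell `b2b-bsdres`, team `x11b3`, seat p6, sub-target R1@3-DESCENT)

HONEST FRAMING (cell `b2b-bsdres`, run/shared/lean/b2b/bsd-rank1-residual/, verbatim in every
file): the goal of the cell is to DELETE the COMBINATION-SHAPED residual classes of the
Birch–Swinnerton-Dyer formula for ALL analytic-rank `≤ 1` elliptic curves over `ℚ` — "full BSD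
formula for every rank `≤ 1` curve in class `C`" assembled STRICTLY from published theorems — so
that the rank-`≤ 1` remainder becomes exactly the CONSTRUCTION-SHAPED classes, which are TYPED
(missing-input `Prop`s), NOT attempted. This is not "finishing BSD". Team `x11b3` (N8/O2: X11b at
`p = 3`); a RESEARCH ROUTE; no claim beyond the stated class; X11 ∧ `r = 1` at `p = 3` stays
CONSTRUCTION-SHAPED / O2 OPEN; nothing here books anything or changes a label. THEOREMS ONLY (no
`def`, no named fact, no `sorry`).

## What this file proves

The stub `stub_tamagawaDescentAt_three` of the skeleton `Three/RouteR1Descent.lean` — link (C) of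
Castella, Camb. J. Math. 6 (2018) §5, read `p`-adically: `TamagawaDescentAt W p K Wd`, i.e.
`ord_p ∏_w c_w(E/K) = ord_p ∏_ℓ c_ℓ(E) + ord_p ∏_ℓ c_ℓ(E^{(d_K)})` — at EVERY ODD prime `p`, for an
erratum field `K` at an ODD multiplicative prime `q` with `p ∤ v_q(Δ_min)`
(`tamagawaDescentAt_of_isErratumField_odd`; the `p = 3` stub verbatim:
`stub_tamagawaDescentAt_three_holds`), from the per-place identity of part 1
(`Three/RouteR1TamagawaPlaces.lean`, `padicValNat_sum_fibre_eq_of_isErratumField`):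

* `padicValNat_tamagawaProduct_baseChange_of_fibrewise` — the place-by-place regrouping of the
  three Tamagawa products along the finite fibres of `w ↦ w ∩ ℤ` (the assembly of multr1-p1's
  `padicValNat_tamagawaProduct_baseChange_quadratic`, with the per-place identity as a HYPOTHESIS
  so that it serves every prime; there `5 ≤ p` is wired in);
* `tamagawaDescentAt_of_isErratumField_odd` — link (C) at every odd `p`;
* `padicValNat_tamagawaProduct_twist_eq_of_isErratumField_odd` — `ord_p ∏c(E^{(d_K)}) = ord_p ∏c(E)`;
* `stub_tamagawaDescentAt_three_holds` — the skeleton's binder, verbatim, at `p = 3`.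

multr1-p1's `tamagawaDescentAt_of_isErratumField` is the case `5 ≤ p` (there `q = 2` is allowed
too; route R1 uses odd `q` only, [Cas20, §2.5] "odd discriminant").

References: [Castella2018] §5 (arXiv:1704.06608 p. 12); [Castella2018Erratum] Thm. A′ (p. 1);
[SilvermanAEC2009] VII.6 Thm. 6.1; [JetchevSkinnerWan2017] §7.3.1 (eq:tamK).
-/

noncomputable section

open scoped Classical

open WeierstrassCurve NumberField IsDedekindDomain Literature.NumberTheory.EllipticCurves
  Literature.NumberTheory.EllipticCurves.Rank1Residual

namespace Summit.BirchSwinnertonDyer.Rank1Residual.X11b.Three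

/-! ### Assembly: the three Tamagawa products regrouped along the fibres of `w ↦ w ∩ ℤ` -/

section Assembly

/-- `ord_p` of a finite product of non-zero naturals is the sum of the `ord_p`. [folklore] -/
private theorem padicValNat_finsetProd {ι : Type*} (p : ℕ) [Fact p.Prime] (s : Finset ι)
    (f : ι → ℕ) (hf : ∀ i ∈ s, f i ≠ 0) :
    padicValNat p (∏ i ∈ s, f i) = ∑ i ∈ s, padicValNat p (f i) := by
  classical
  induction s using Finset.induction_on with
  | empty => simp
  | insert a s ha ih =>
    rw [Finset.prod_insert ha, Finset.sum_insert ha,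
      padicValNat.mul (hf a (Finset.mem_insert_self a s))
        (Finset.prod_ne_zero_iff.mpr fun i hi => hf i (Finset.mem_insert_of_mem hi)),
      ih fun i hi => hf i (Finset.mem_insert_of_mem hi)]

variable (W : WeierstrassCurve ℚ) [W.IsElliptic] [W.IsGloballyMinimal] (p : ℕ) [Fact p.Prime]
  (K : Type) [Field K] [NumberField K] (Wd : WeierstrassCurve ℚ) [Wd.IsElliptic]

omit [W.IsGloballyMinimal] in
/-- **Tamagawa numbers in a base change to a number field, `p`-adically, from a fibrewise
identity.** For `W/ℚ` and `Wd/ℚ` elliptic, a number field `K`, and ANY prime `p`: if at every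
finite place `v` of `ℚ` the local identity `Σ_{w ∣ v} ord_p c_w(E_K) = ord_p c_v(E) + ord_p c_v(Wd)`
holds, then `ord_p ∏_w c_w(E/K) = ord_p ∏_ℓ c_ℓ(E) + ord_p ∏_ℓ c_ℓ(Wd)`. The three Tamagawa
products are finite products over the places (`mulSupport_localTamagawaNumber_finite_holds`), the
`K`-side regrouped along the finite fibres of `w ↦ w ∩ ℤ` (`Finset.sum_fiberwise_of_maps_to`) —
the assembly step of multr1-p1's `padicValNat_tamagawaProduct_baseChange_quadratic`, stated with the
per-place identity as a hypothesis so that it serves every prime (there `5 ≤ p` is wired in).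
[cite: Castella2018, §5 (arXiv:1704.06608 p. 12), Tamagawa relation] -/
theorem padicValNat_tamagawaProduct_baseChange_of_fibrewise
    (hplace : ∀ v : HeightOneSpectrum (𝓞 ℚ),
      ∑ w ∈ (HeightOneSpectrum.finite_setOf_under_eq_of_numberField (K := K) v).toFinset,
          padicValNat p ((((W.baseChange K).baseChange (w.adicCompletion K)).localTamagawaNumber
            (w.adicCompletionIntegers K))) =
        padicValNat p ((W.baseChange (v.adicCompletion ℚ)).localTamagawaNumber
            (v.adicCompletionIntegers ℚ)) +
          padicValNat p ((Wd.baseChange (v.adicCompletion ℚ)).localTamagawaNumber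
            (v.adicCompletionIntegers ℚ))) :
    padicValNat p (W.baseChange K).tamagawaProduct =
      padicValNat p W.tamagawaProduct + padicValNat p Wd.tamagawaProduct := by
  haveI hEK : (W.baseChange K).IsElliptic := by rw [baseChange]; infer_instance
  -- the three local Tamagawa functions
  set cK : HeightOneSpectrum (𝓞 K) → ℕ := fun w =>
    ((W.baseChange K).baseChange (w.adicCompletion K)).localTamagawaNumber
      (w.adicCompletionIntegers K) with hcK
  set cQ : HeightOneSpectrum (𝓞 ℚ) → ℕ := fun v =>
    (W.baseChange (v.adicCompletion ℚ)).localTamagawaNumber (v.adicCompletionIntegers ℚ) with hcQ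
  set cD : HeightOneSpectrum (𝓞 ℚ) → ℕ := fun v =>
    (Wd.baseChange (v.adicCompletion ℚ)).localTamagawaNumber (v.adicCompletionIntegers ℚ) with hcD
  have hfinK : (Function.mulSupport cK).Finite :=
    (W.baseChange K).mulSupport_localTamagawaNumber_finite_holds
  have hfinQ : (Function.mulSupport cQ).Finite := W.mulSupport_localTamagawaNumber_finite_holds
  have hfinD : (Function.mulSupport cD).Finite := Wd.mulSupport_localTamagawaNumber_finite_holds
  -- fibres of `K → ℚ` on places and the finite index sets
  set F : HeightOneSpectrum (𝓞 ℚ) → Finset (HeightOneSpectrum (𝓞 K)) := fun v =>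
    (HeightOneSpectrum.finite_setOf_under_eq_of_numberField (K := K) v).toFinset with hF
  have hmemF : ∀ v w, w ∈ F v ↔ w.under (𝓞 ℚ) = v := fun v w => by
    simp [hF, Set.Finite.mem_toFinset]
  set SQ : Finset (HeightOneSpectrum (𝓞 ℚ)) :=
    hfinK.toFinset.image (fun w => w.under (𝓞 ℚ)) ∪ hfinQ.toFinset ∪ hfinD.toFinset with hSQ
  set SK : Finset (HeightOneSpectrum (𝓞 K)) := SQ.biUnion F with hSK
  have hsubK : Function.mulSupport cK ⊆ ↑SK := by
    intro w hw
    rw [Finset.mem_coe, hSK, Finset.mem_biUnion]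
    refine ⟨w.under (𝓞 ℚ), ?_, (hmemF _ _).mpr rfl⟩
    rw [hSQ, Finset.mem_union, Finset.mem_union, Finset.mem_image]
    exact Or.inl (Or.inl ⟨w, hfinK.mem_toFinset.mpr hw, rfl⟩)
  have hsubQ : Function.mulSupport cQ ⊆ ↑SQ := fun v hv => by
    rw [Finset.mem_coe, hSQ, Finset.mem_union, Finset.mem_union]
    exact Or.inl (Or.inr (hfinQ.mem_toFinset.mpr hv))
  have hsubD : Function.mulSupport cD ⊆ ↑SQ := fun v hv => by
    rw [Finset.mem_coe, hSQ, Finset.mem_union, Finset.mem_union]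
    exact Or.inr (hfinD.mem_toFinset.mpr hv)
  -- `ord_p` of the three products as sums over the index sets
  have hK' : padicValNat p (W.baseChange K).tamagawaProduct = ∑ w ∈ SK, padicValNat p (cK w) := by
    rw [show (W.baseChange K).tamagawaProduct = ∏ᶠ w, cK w from rfl,
      finprod_eq_prod_of_mulSupport_subset cK hsubK]
    exact padicValNat_finsetProd p SK cK fun w _ =>
      (W.baseChange K).localTamagawaNumber_baseChange_ne_zero w
  have hQ' : padicValNat p W.tamagawaProduct = ∑ v ∈ SQ, padicValNat p (cQ v) := by
    rw [show W.tamagawaProduct = ∏ᶠ v, cQ v from rfl,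
      finprod_eq_prod_of_mulSupport_subset cQ hsubQ]
    exact padicValNat_finsetProd p SQ cQ fun v _ => W.localTamagawaNumber_baseChange_ne_zero v
  have hD' : padicValNat p Wd.tamagawaProduct = ∑ v ∈ SQ, padicValNat p (cD v) := by
    rw [show Wd.tamagawaProduct = ∏ᶠ v, cD v from rfl,
      finprod_eq_prod_of_mulSupport_subset cD hsubD]
    exact padicValNat_finsetProd p SQ cD fun v _ => Wd.localTamagawaNumber_baseChange_ne_zero v
  -- regroup the `K`-side along the fibres
  have hmaps : ∀ w ∈ SK, w.under (𝓞 ℚ) ∈ SQ := by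
    intro w hw
    rw [hSK, Finset.mem_biUnion] at hw
    obtain ⟨v, hv, hwv⟩ := hw
    rwa [(hmemF v w).mp hwv]
  have hfib : ∀ v ∈ SQ, SK.filter (fun w => w.under (𝓞 ℚ) = v) = F v := by
    intro v hv
    ext w
    simp only [Finset.mem_filter, hmemF]
    constructor
    · exact fun h => h.2
    · intro h
      refine ⟨?_, h⟩
      rw [hSK, Finset.mem_biUnion]
      exact ⟨v, hv, (hmemF v w).mpr h⟩
  rw [hK', hQ', hD', ← Finset.sum_fiberwise_of_maps_to hmaps, ← Finset.sum_add_distrib]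
  refine Finset.sum_congr rfl fun v hv => ?_
  rw [hfib v hv]
  exact hplace v

end Assembly

/-! ### Link (C) at every odd prime on erratum fields; the `p = 3` stub -/

section Erratum

/-- **Link (C) of route R1 PROVED at every ODD prime on an erratum field at an ODD `q`**
(`TamagawaDescentAt W p K Wd` of `CastellaErratum.lean`): for `W/ℚ` globally minimal elliptic, an
odd prime `p`, an odd prime `q` of multiplicative reduction with `p ∤ ord_q(Δ_min)` (`E[p]`
ramified at `q`), an erratum field `K` for `q` and any elliptic model `Wd` of `E^{(d_K)}`:
`ord_p ∏_w c_w(E/K) = ord_p ∏_ℓ c_ℓ(E) + ord_p ∏_ℓ c_ℓ(E^{(d_K)})`. Castella 2018 §5's "immediate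
relation" / the erratum's "same argument", at `p = 3` included (multr1-p1's
`tamagawaDescentAt_of_isErratumField`: `5 ≤ p`). Per place: `padicValNat_sum_fibre_eq_of_isErratumField`;
assembly: `padicValNat_tamagawaProduct_baseChange_of_fibrewise`.
[cite: Castella2018, §5 (arXiv:1704.06608 p. 12), Tamagawa relation]
[cite: Castella2018Erratum, Thm. A′ and "the same argument as in [Cas18, §5]" (p. 1)] -/
theorem tamagawaDescentAt_of_isErratumField_odd (W : WeierstrassCurve ℚ) [W.IsElliptic]
    [W.IsGloballyMinimal] (p : ℕ) [Fact p.Prime] (hp2 : p ≠ 2) (q : ℕ) [Fact q.Prime] (hq2 : q ≠ 2)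
    (hmq : Mult W q) (hvq : ¬ p ∣ padicValInt q W.minimalDiscriminantInt)
    (K : Type) [Field K] [NumberField K] (hK : IsErratumField W K q)
    (Wd : WeierstrassCurve ℚ) [Wd.IsElliptic]
    (hWd : ∃ C : VariableChange ℚ, C • W.quadraticTwist (NumberField.discr K : ℚ) = Wd) :
    TamagawaDescentAt W p K Wd := by
  obtain ⟨C, hC⟩ := hWd
  haveI hEK : (W.baseChange K).IsElliptic := by rw [baseChange]; infer_instance
  exact padicValNat_tamagawaProduct_baseChange_of_fibrewise W p K Wd fun v =>
    (padicValNat_sum_fibre_eq_of_isErratumField W p hp2 K hq2 hmq hvq hK Wd hC v).1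

/-- **`ord_p ∏_ℓ c_ℓ(E^{(d_K)}) = ord_p ∏_ℓ c_ℓ(E)`** at every odd `p` on an erratum field at an odd
`q` (the twist half of the per-place identity, assembled over the common finite support) — the odd-`p`
version of multr1-p1's `padicValNat_tamagawaProduct_quadraticTwist_eq` on erratum fields.
[cite: Castella2018, §5 (arXiv:1704.06608 p. 12), Tamagawa relation] -/
theorem padicValNat_tamagawaProduct_twist_eq_of_isErratumField_odd (W : WeierstrassCurve ℚ)
    [W.IsElliptic] [W.IsGloballyMinimal] (p : ℕ) [Fact p.Prime] (hp2 : p ≠ 2) (q : ℕ)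
    [Fact q.Prime] (hq2 : q ≠ 2) (hmq : Mult W q) (hvq : ¬ p ∣ padicValInt q W.minimalDiscriminantInt)
    (K : Type) [Field K] [NumberField K] (hK : IsErratumField W K q)
    (Wd : WeierstrassCurve ℚ) [Wd.IsElliptic]
    (hWd : ∃ C : VariableChange ℚ, C • W.quadraticTwist (NumberField.discr K : ℚ) = Wd) :
    padicValNat p Wd.tamagawaProduct = padicValNat p W.tamagawaProduct := by
  obtain ⟨C, hC⟩ := hWd
  haveI hEK : (W.baseChange K).IsElliptic := by rw [baseChange]; infer_instance
  set cQ : HeightOneSpectrum (𝓞 ℚ) → ℕ := fun v =>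
    (W.baseChange (v.adicCompletion ℚ)).localTamagawaNumber (v.adicCompletionIntegers ℚ) with hcQ
  set cD : HeightOneSpectrum (𝓞 ℚ) → ℕ := fun v =>
    (Wd.baseChange (v.adicCompletion ℚ)).localTamagawaNumber (v.adicCompletionIntegers ℚ) with hcD
  have hfinQ : (Function.mulSupport cQ).Finite := W.mulSupport_localTamagawaNumber_finite_holds
  have hfinD : (Function.mulSupport cD).Finite := Wd.mulSupport_localTamagawaNumber_finite_holds
  set S : Finset (HeightOneSpectrum (𝓞 ℚ)) := hfinQ.toFinset ∪ hfinD.toFinset with hS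
  have hsubQ : Function.mulSupport cQ ⊆ ↑S := fun v hv => by
    rw [Finset.mem_coe, hS, Finset.mem_union]; exact Or.inl (hfinQ.mem_toFinset.mpr hv)
  have hsubD : Function.mulSupport cD ⊆ ↑S := fun v hv => by
    rw [Finset.mem_coe, hS, Finset.mem_union]; exact Or.inr (hfinD.mem_toFinset.mpr hv)
  rw [show Wd.tamagawaProduct = ∏ᶠ v, cD v from rfl, show W.tamagawaProduct = ∏ᶠ v, cQ v from rfl,
    finprod_eq_prod_of_mulSupport_subset cD hsubD, finprod_eq_prod_of_mulSupport_subset cQ hsubQ,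
    padicValNat_finsetProd p S cD fun v _ => Wd.localTamagawaNumber_baseChange_ne_zero v,
    padicValNat_finsetProd p S cQ fun v _ => W.localTamagawaNumber_baseChange_ne_zero v]
  exact Finset.sum_congr rfl fun v _ =>
    (padicValNat_sum_fibre_eq_of_isErratumField W p hp2 K hq2 hmq hvq hK Wd hC v).2

/-- **The stub `stub_tamagawaDescentAt_three` of `Three/RouteR1Descent.lean`, DISCHARGED** — its
binder type verbatim: for every globally minimal elliptic `W/ℚ`, odd prime `q` of multiplicative
reduction with `3 ∤ ord_q(Δ_min)`, erratum field `K` for `q` and elliptic model `Wd` of `E^{(d_K)}`,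
`TamagawaDescentAt W 3 K Wd` (`tamagawaDescentAt_of_isErratumField_odd` at `p = 3`).
[cite: Castella2018, §5 (arXiv:1704.06608 p. 12), Tamagawa relation] -/
theorem stub_tamagawaDescentAt_three_holds :
    ∀ (W : WeierstrassCurve ℚ) [W.IsElliptic] [W.IsGloballyMinimal]
      (q : ℕ) [Fact q.Prime] (K : Type) [Field K] [NumberField K] (Wd : WeierstrassCurve ℚ)
      [Wd.IsElliptic], q ≠ 2 → Mult W q → ¬ 3 ∣ padicValInt q W.minimalDiscriminantInt →
      IsErratumField W K q →
      (∃ C : VariableChange ℚ, C • W.quadraticTwist (NumberField.discr K : ℚ) = Wd) →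
      TamagawaDescentAt W 3 K Wd :=
  fun W _ _ q _ K _ _ Wd _ hq2 hmq hvq hK hWd ↦
    tamagawaDescentAt_of_isErratumField_odd W 3 (by decide) q hq2 hmq hvq K hK Wd hWd

end Erratum

end Summit.BirchSwinnertonDyer.Rank1Residual.X11b.Three

end
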